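import Summits.Parity.GeneralizedHardyLittlewood.Theorems.LeeYangFibresCellParityLawSieveDefs
import Summits.Parity.GeneralizedHardyLittlewood.Theorems.LeeYangFibresCellParityLawSingularRatio
import Literature.NumberTheory.Sieve.RosserSieveTheoremOneHalfLt
import Literature.NumberTheory.Sieve.SieveFunctionsBridge
import Literature.NumberTheory.Sieve.LinearSieveConstant
import Literature.NumberTheory.Sieve.LinearFormsRoughTupleBound
import Literature.NumberTheory.Sieve.LinearEquationsInPrimesSubsystems
import Literature.NumberTheory.Sieve.RoughOmegaCellsLocalAPPrep
import HarnessLib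

/-!
# Route `LeeYangFibres`, crux `CellParityLaw` (stmt-Parity-14109), line `section-annihilator`:
# the registered stub `stub_prLawTopCellAll` — the top cell at EVERY roughness `u ≥ 2`

Granted `SectionSeqFacts`, `SectionDimension` (uniform `Ω(1, L')`), `SectionMertens` (crude clause), `PrLawTwoPrep`
and the atom `SectionLevelAt t`, the TOP CELL at roughness `u ≥ 2` — points `n ∈ [-N, N] ∩ K` with
`ψ_i(n) = p₁ ⋯ p_u`, all `p_k > N^{1/u}` (model density `a_u = 0`), the other forms frozen in their rough `Ω`-cells —
is `≤ N/(log^{t+1} N (log log N)^B)` for `N ≥ N₀(t, L, u, B)` in the non-degenerate case (the `u = 2` rung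
`PrLawTwoTopCell` with exponents `1/u, 1/(2u), 1/(4u)`). Proof: a value `V = ψ_i(n) ≤ 2LN` of the cell has
`p₁ = P⁻(V) > N^{1/u}` with `p₁^u ≤ V`, so `p₁ ≤ M = ⌈(2L+1) N^{1/u}⌉` (a narrow window), and `q = V/p₁`
(`Ω(q) = u - 1 ≥ 1`) is coprime to `P(z)`, `z = N^{1/(4u)}`: the cell is at most `∑_{p ∈ window} S(b_p, z)`,
`b_p(q) = b(pq)`. Iwaniec's linear sieve (`Iwaniec1980_thm1_upper_of_half_lt`, `κ = 1`, uniform over `Ω(1, L')`;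
`y = N^{1/(2u)}`, `s = 2`, `F(2) = e^γ`) bounds `S(b_p, z)` by `g(p) F V(z) (e^γ + |C_I|)` plus remainders which ARE
the atom's discrepancies at the moduli `pd` (`SectionSeqFacts` (b)); `∑_p g(p) ≪_{u,L,L'} 1/log N` from `Ω(1, L')`,
`V(z) ≤ 4u C log log N/log N`, `F ≤ C (log log N)^t N/log^t N` (`uniformRoughTupleBound`), and the remainders
re-index through `(p, d) ↦ pd ≤ N^{1 - 1/log log N}` into the atom (`PrLawTwoPrep` (e)), saving `log^{-(t+3)} N`.
References: H. Iwaniec, Acta Arith. 36 (1980) 171–202, Thm 1 [IwaniecActaArith1980]; E. Bombieri, RIMS Kôkyûroku 294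
(1977) p. 5 [BombieriRIMS1977].
-/

noncomputable section

open scoped BigOperators Topology Classical
open Finset Filter Literature.NumberTheory.Sieve

namespace Summit.Parity.GeneralizedHardyLittlewood.Cruxes.CellParityLaw.SectionAnnihilator

namespace TopCellAllAux

/-- **Decomposition of a value of the top cell.** If `Ω(v) = u ≥ 2`, `P⁻(v) > w ≥ z`, `v ≤ M^u` and `v ≤ x`, then
`p₁ = P⁻(v)` is a prime of the window `w < p₁ ≤ M` (`p₁^u = P⁻(v)^{Ω(v)} ≤ v ≤ M^u`) and `q = v/p₁` satisfies
`0 < q ≤ x` and is coprime to `P(z)` (`Ω(q) = u - 1 ≥ 1`, so `P⁻(q)` is a prime factor of `v`, `≥ p₁ ≥ z`). -/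
theorem rough_value_decomp {v u M : ℕ} {w x z : ℝ} (hu : 2 ≤ u) (hΩ : ArithmeticFunction.cardFactors v = u)
    (hrough : w < (v.minFac : ℝ)) (hzw : z ≤ w) (hvM : v ≤ M ^ u) (hvx : (v : ℝ) ≤ x) :
    ((1 ≤ v.minFac ∧ v.minFac ≤ M) ∧ v.minFac.Prime ∧ w < (v.minFac : ℝ)) ∧
      ((0 < v / v.minFac ∧ v / v.minFac ≤ ⌊x⌋₊) ∧ (v / v.minFac).Coprime (primesProdBelow z)) ∧
        v.minFac * (v / v.minFac) = v := by
  have h1 : 1 < v := ArithmeticFunction.cardFactors_pos_iff_one_lt.mp (by rw [hΩ]; omega)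
  have hp₁ : v.minFac.Prime := Nat.minFac_prime (by omega)
  have hpq : v.minFac * (v / v.minFac) = v := Nat.mul_div_cancel' (Nat.minFac_dvd v)
  have hq0 : v / v.minFac ≠ 0 := fun h => absurd hpq (by rw [h, mul_zero]; omega)
  have hq1 : v / v.minFac ≠ 1 := by
    intro h
    have hmul := ArithmeticFunction.cardFactors_mul hp₁.ne_zero hq0
    rw [hpq, hΩ, ArithmeticFunction.cardFactors_apply_prime hp₁, h, ArithmeticFunction.cardFactors_one] at hmul
    omega
  have hle : v.minFac ≤ (v / v.minFac).minFac := Nat.minFac_le_of_dvd (Nat.minFac_prime hq1).two_le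
    ((Nat.minFac_dvd _).trans (Nat.div_dvd_of_dvd (Nat.minFac_dvd v)))
  have hpow : v.minFac ^ u ≤ v := by -- `P⁻(v)^{Ω(v)} ≤ v`, all `Ω(v)` prime factors being `≥ P⁻(v)`
    rw [← hΩ, ArithmeticFunction.cardFactors_apply]
    conv_rhs => rw [← Nat.prod_primeFactorsList (by omega : v ≠ 0)]
    exact List.pow_card_le_prod _ _ fun p hp =>
      Nat.minFac_le_of_dvd (Nat.prime_of_mem_primeFactorsList hp).two_le (Nat.dvd_of_mem_primeFactorsList hp)
  refine ⟨⟨⟨hp₁.one_lt.le, (Nat.pow_le_pow_iff_left (by omega : u ≠ 0)).mp (hpow.trans hvM)⟩, hp₁, hrough⟩,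
    ⟨⟨Nat.pos_of_ne_zero hq0, Nat.le_floor ((Nat.cast_le.mpr (Nat.div_le_self _ _)).trans hvx)⟩, ?_⟩, hpq⟩
  refine (coprime_primesProdBelow_iff _ _).mpr fun p hp hpq' => ?_
  rw [Nat.mem_primesBelow] at hp
  have h2 : (v.minFac : ℝ) ≤ p := Nat.cast_le.mpr (hle.trans (Nat.minFac_le_of_dvd hp.2.two_le hpq'))
  linarith [Nat.lt_ceil.mp hp.1]

/-- **The window bound** read off `Ω(1, L')`: for the primes `w < p ≤ M` with `M + 1 ≤ c w` (`w ≥ 2`, `c ≥ 1`),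
`∑_p g(p) ≤ ∑_p log (1 - g(p))⁻¹ ≤ log ((log (M+1) / log w)(1 + L'/log w)) ≤ (log (M+1) / log w - 1) + L'/log w`. -/
theorem window_sum_le {t : ℕ} {Ψ : Fin (t + 1) → AffLinForm 1} {i : Fin (t + 1)} {L' : ℝ}
    (hdim : HasIwaniecDimension (sectionDensityFn Ψ i) 1 L') {w c : ℝ} {M : ℕ} (hw : 2 ≤ w) (hc : 1 ≤ c)
    (hM : (M : ℝ) + 1 ≤ c * w) :
    ∑ p ∈ (Finset.Icc 1 M).filter (fun p : ℕ => p.Prime ∧ w < (p : ℝ)), sectionDensity Ψ i p ≤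
      (Real.log c + |L'|) / Real.log w := by
  set W := (Finset.Icc 1 M).filter (fun p : ℕ => p.Prime ∧ w < (p : ℝ)) with hWdef
  have hW : ∀ p ∈ W, p.Prime ∧ w ≤ (p : ℝ) ∧ (p : ℝ) < (M : ℝ) + 1 := fun p hp => by
    have h := Finset.mem_filter.mp hp
    have hpM : (p : ℝ) ≤ M := by exact_mod_cast (Finset.mem_Icc.mp h.1).2
    exact ⟨h.2.1, h.2.2.le, by linarith⟩
  have hw0 : 0 < w := by linarith
  have hlogw : 0 < Real.log w := Real.log_pos (by linarith)
  rcases W.eq_empty_or_nonempty with hWe | ⟨p₀, hp₀⟩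
  · rw [hWe, Finset.sum_empty]
    exact div_nonneg (add_nonneg (Real.log_nonneg hc) (abs_nonneg _)) hlogw.le
  have hwz : w ≤ (M : ℝ) + 1 := by have h := hW p₀ hp₀; linarith [h.2.1, h.2.2]
  have ha : 0 < Real.log ((M : ℝ) + 1) / Real.log w := div_pos (by linarith [Real.log_le_log hw0 hwz]) hlogw
  have hb : 0 < 1 + L' / Real.log w := by have := hdim.nonneg; positivity
  have hlogzc : Real.log ((M : ℝ) + 1) ≤ Real.log c + Real.log w := by
    rw [← Real.log_mul (by linarith) hw0.ne']
    exact Real.log_le_log (by linarith) hM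
  set g := sectionDensityFn Ψ i with hg
  set S := (Nat.primesBelow ⌈(M : ℝ) + 1⌉₊).filter (fun p : ℕ => w ≤ (p : ℝ)) with hS
  have hlt : ∀ p ∈ S, 0 ≤ g p ∧ g p < 1 := fun p hp => hdim.1 p (Nat.prime_of_mem_primesBelow (Finset.mem_filter.mp hp).1)
  have hfac : ∀ p ∈ S, 0 < (1 - g p)⁻¹ := fun p hp => inv_pos.mpr (sub_pos.mpr (hlt p hp).2)
  calc ∑ p ∈ W, sectionDensity Ψ i p = ∑ p ∈ W, g p :=
        Finset.sum_congr rfl fun p hp => (sectionDensityFn_apply Ψ i (hW p hp).1.ne_zero).symm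
    _ ≤ ∑ p ∈ S, g p :=
        Finset.sum_le_sum_of_subset_of_nonneg (fun p hp => Finset.mem_filter.mpr
          ⟨Nat.mem_primesBelow.mpr ⟨Nat.lt_ceil.mpr (hW p hp).2.2, (hW p hp).1⟩, (hW p hp).2.1⟩) fun p hp _ => (hlt p hp).1
    _ ≤ ∑ p ∈ S, Real.log (1 - g p)⁻¹ := by
        refine Finset.sum_le_sum fun p hp => ?_
        have h2 : Real.log (1 - g p) ≤ -g p := by
          rw [Real.log_le_iff_le_exp (sub_pos.mpr (hlt p hp).2)]
          linarith [Real.add_one_le_exp (-g p)]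
        rw [Real.log_inv]
        linarith
    _ = Real.log (∏ p ∈ S, (1 - g p)⁻¹) := (Real.log_prod fun p hp => (hfac p hp).ne').symm
    _ ≤ Real.log (Real.log ((M : ℝ) + 1) / Real.log w * (1 + L' / Real.log w)) := by
        refine Real.log_le_log (Finset.prod_pos hfac) ?_
        have := hdim.2 w ((M : ℝ) + 1) hw hwz
        rwa [Real.rpow_one] at this
    _ ≤ (Real.log ((M : ℝ) + 1) / Real.log w - 1) + (1 + L' / Real.log w - 1) := by
        rw [Real.log_mul ha.ne' hb.ne']
        exact add_le_add (Real.log_le_sub_one_of_pos ha) (Real.log_le_sub_one_of_pos hb)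
    _ = (Real.log ((M : ℝ) + 1) - Real.log w + L') / Real.log w := by field_simp; ring
    _ ≤ (Real.log c + |L'|) / Real.log w := div_le_div_of_nonneg_right (by linarith [le_abs_self L']) hlogw.le

/-- **The budget**: `K m^{t+1} N / ℓ^{t+2} + N / ℓ^{t+3} ≤ N / (ℓ^{t+1} m^B)` once `2 K m^{t+1+B} ≤ ℓ` and
`2 m^B ≤ ℓ` (`ℓ ≥ 1`, `m > 0`): each summand is at most half the budget. -/
theorem budget_le {K ℓ m Nr : ℝ} {t B : ℕ} (hℓ : 1 ≤ ℓ) (hm : 0 < m) (hN : 0 ≤ Nr)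
    (hK : 2 * K * m ^ (t + 1 + B) ≤ ℓ) (h2 : 2 * m ^ B ≤ ℓ) :
    K * m ^ (t + 1) * Nr / ℓ ^ (t + 2) + Nr / ℓ ^ (t + 3) ≤ Nr / (ℓ ^ (t + 1) * m ^ B) := by
  have hℓ0 : 0 < ℓ := by linarith
  have hmain : K * m ^ (t + 1) * Nr / ℓ ^ (t + 2) ≤ Nr / (ℓ ^ (t + 1) * m ^ B) / 2 := by
    rw [div_div, div_le_div_iff₀ (by positivity) (by positivity)]
    calc K * m ^ (t + 1) * Nr * (ℓ ^ (t + 1) * m ^ B * 2) = Nr * ℓ ^ (t + 1) * (2 * K * m ^ (t + 1 + B)) := by ring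
      _ ≤ Nr * ℓ ^ (t + 1) * ℓ := mul_le_mul_of_nonneg_left hK (by positivity)
      _ = Nr * ℓ ^ (t + 2) := by ring
  have hrem : Nr / ℓ ^ (t + 3) ≤ Nr / (ℓ ^ (t + 1) * m ^ B) / 2 := by
    rw [div_div, div_le_div_iff₀ (by positivity) (by positivity)]
    calc Nr * (ℓ ^ (t + 1) * m ^ B * 2) = Nr * ℓ ^ (t + 1) * (2 * m ^ B) := by ring
      _ ≤ Nr * ℓ ^ (t + 1) * ℓ := mul_le_mul_of_nonneg_left h2 (by positivity)
      _ ≤ Nr * ℓ ^ (t + 1) * ℓ ^ 2 := mul_le_mul_of_nonneg_left (by nlinarith) (by positivity)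
      _ = Nr * ℓ ^ (t + 3) := by ring
  linarith

/-- The re-indexed moduli fit under the atom's level: `p d ≤ N^{7/8} ≤ N^{1 - 1/log log N}` for `p ≤ M`,
`M + 1 ≤ c N^{1/u}`, `u ≥ 2`, `1 ≤ c ≤ N^{1/8}`, `d < N^{1/(2u)}` and `log log N ≥ 8`. -/
theorem mul_le_level {N M p d u : ℕ} {c : ℝ} (hu : 2 ≤ u) (hN1 : (1 : ℝ) ≤ N) (hc1 : 1 ≤ c)
    (hc : c ≤ (N : ℝ) ^ ((1 : ℝ) / 8)) (hM : (M : ℝ) + 1 ≤ c * (N : ℝ) ^ ((1 : ℝ) / u))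
    (hm : 8 ≤ Real.log (Real.log N)) (hp : p ≤ M) (hd : d < ⌈(N : ℝ) ^ ((1 : ℝ) / (2 * u))⌉₊) :
    p * d ≤ ⌊(N : ℝ) ^ (1 - 1 / Real.log (Real.log N) ^ 1)⌋₊ := by
  have hN0 : (0 : ℝ) < N := by linarith
  have hu2 : (2 : ℝ) ≤ u := by exact_mod_cast hu
  rw [Nat.le_floor_iff (Real.rpow_nonneg hN0.le _), Nat.cast_mul]
  have hwu : (N : ℝ) ^ ((1 : ℝ) / u) ≤ (N : ℝ) ^ ((1 : ℝ) / 2) :=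
    Real.rpow_le_rpow_of_exponent_le hN1 (one_div_le_one_div_of_le two_pos hu2)
  have hp' : (p : ℝ) ≤ c * (N : ℝ) ^ ((1 : ℝ) / 2) := by
    have : (p : ℝ) ≤ M := by exact_mod_cast hp
    linarith [mul_le_mul_of_nonneg_left hwu (by linarith : (0 : ℝ) ≤ c)]
  have hd' : (d : ℝ) < (N : ℝ) ^ ((1 : ℝ) / 4) := (Nat.lt_ceil.mp hd).trans_le
    (Real.rpow_le_rpow_of_exponent_le hN1 (one_div_le_one_div_of_le (by norm_num) (by linarith)))
  have hexp : (7 : ℝ) / 8 ≤ 1 - 1 / Real.log (Real.log N) ^ 1 := by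
    have : 1 / Real.log (Real.log N) ≤ 1 / 8 := one_div_le_one_div_of_le (by norm_num) hm
    rw [pow_one]
    linarith
  calc (p : ℝ) * d ≤ (c * (N : ℝ) ^ ((1 : ℝ) / 2)) * (N : ℝ) ^ ((1 : ℝ) / 4) :=
        mul_le_mul hp' hd'.le (Nat.cast_nonneg d) ((Nat.cast_nonneg p).trans hp')
    _ ≤ ((N : ℝ) ^ ((1 : ℝ) / 8) * (N : ℝ) ^ ((1 : ℝ) / 2)) * (N : ℝ) ^ ((1 : ℝ) / 4) := by gcongr
    _ = (N : ℝ) ^ ((7 : ℝ) / 8) := by rw [← Real.rpow_add hN0, ← Real.rpow_add hN0]; norm_num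
    _ ≤ (N : ℝ) ^ (1 - 1 / Real.log (Real.log N) ^ 1) := Real.rpow_le_rpow_of_exponent_le hN1 hexp

variable {t : ℕ} (Ψ : Fin (t + 1) → AffLinForm 1) (K : Set (Fin 1 → ℝ)) (N u : ℕ) (i : Fin (t + 1)) (j' : Fin t → ℕ)

/-- **The top cell against the sifted divisor sequences of the window.** For `u ≥ 2`, `z ≤ N^{1/u}`, once `x` and
`M^u` bound every value of `ψ_i` on the box, `C_{(u,j')} ≤ ∑_{N^{1/u} < p ≤ M prime} S(b_p, z)`,
`S(b_p, z) = ∑_{q ≤ x, (q, P(z)) = 1} b(pq)`: the cell lies in the union over `(p₁, q) = (P⁻(ψ_i(n)), ψ_i(n)/P⁻(ψ_i(n)))`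
(`rough_value_decomp`) of the fibres `{ψ_i = p₁ q}` counted by the section weight. -/
theorem cell_top_le_sum {x z : ℝ} {M : ℕ} (hu : 2 ≤ u) (hx : ∀ n ∈ latticeBox 1 N, (((Ψ i).eval n : ℤ) : ℝ) ≤ x)
    (hM : ∀ n ∈ latticeBox 1 N, (Ψ i).eval n ≤ (M : ℤ) ^ u) (hzN : z ≤ (N : ℝ) ^ ((1 : ℝ) / u)) :
    (cell Ψ K N u (i.insertNth u j') : ℝ) ≤
      ∑ p ∈ (Finset.Icc 1 M).filter (fun p : ℕ => p.Prime ∧ (N : ℝ) ^ ((1 : ℝ) / u) < (p : ℝ)),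
        (sectionSeq Ψ K N u i j' p).sifted x (primesProdBelow z) := by
  have ha : ∀ p q : ℕ, (sectionSeq Ψ K N u i j' p).a q = (sectionWeight Ψ K N u i j' (p * q) : ℝ) := fun _ _ => rfl
  simp only [SieveSequence.sifted, ha, ← Nat.cast_sum, Nat.cast_le, ← Finset.sum_product']
  unfold cell sectionWeight
  refine le_trans (Finset.card_le_card fun n hn => ?_) Finset.card_biUnion_le
  rw [Finset.mem_filter] at hn
  obtain ⟨hbox, hK, hall⟩ := hn
  obtain ⟨hrough, hΩ⟩ := hall i
  rw [Fin.insertNth_apply_same] at hΩ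
  have h1 : 1 < ((Ψ i).eval n).toNat := ArithmeticFunction.cardFactors_pos_iff_one_lt.mp (by rw [hΩ]; omega)
  have hveq : ((((Ψ i).eval n).toNat : ℕ) : ℤ) = (Ψ i).eval n := by omega
  have hvM := hM n hbox
  have hxn := hx n hbox
  rw [← hveq] at hvM hxn
  rw [Int.cast_natCast] at hxn
  obtain ⟨hP, hT, hpq⟩ := rough_value_decomp hu hΩ hrough hzN (by exact_mod_cast hvM) hxn
  rw [Finset.mem_biUnion]
  refine ⟨(((Ψ i).eval n).toNat.minFac, ((Ψ i).eval n).toNat / ((Ψ i).eval n).toNat.minFac), ?_, ?_⟩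
  · rw [Finset.mem_product, Finset.mem_filter, Finset.mem_filter, Finset.mem_Icc, Finset.mem_Ioc]
    exact ⟨hP, hT⟩
  · rw [Finset.mem_filter]
    refine ⟨hbox, hK, by rw [hpq, hveq], fun k => ?_⟩
    have hk := hall (i.succAbove k)
    rwa [Fin.insertNth_apply_succAbove] at hk

/-- **The top cell at roughness `u` against four numerical bounds.** After `cell_top_le_sum`, the linear sieve `hI` on
the divisor sequence `b_p` at `s = 2` gives the main term `g(p) F V(z) (F(2) + |C_I|)` (`log^{-1/3} y ≤ 1`) and remainders
`R_d`, `d < y`, `d ∣ P(z)` (so `d` is coprime to `p ≥ z`), which ARE the atom's discrepancies at the moduli `pd`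
(`SectionSeqFacts` (b)); then ANY bounds `a` for the window sum `∑_p g(p)`, `b` for the fibre mass `F`, `v` for `V(z)`
and `r` for the re-indexed remainders give `C_{(u,j')} ≤ a b v (F(2) + |C_I|) + r`. -/
theorem cell_top_le (hSF : SectionSeqFacts) (hu : 2 ≤ u) {L' CI G : ℝ} {Fup : ℝ → ℝ}
    (hI : ∀ A : SieveSequence, HasIwaniecDimension A.density 1 L' → ∀ x y z : ℝ, 2 ≤ z → z ≤ y →
      0 ≤ A.size x → A.sifted x (primesProdBelow z) ≤
        A.size x * A.densityProduct (primesProdBelow z) * (Fup (Real.log y / Real.log z) + CI * Real.log y ^ (-(1 / 3 : ℝ))) +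
          ∑ d ∈ (Finset.range ⌈y⌉₊).filter (· ∣ primesProdBelow z), |A.remainder d x|)
    (hF2 : Fup 2 = G) (hG : 0 ≤ G) (hdim : HasIwaniecDimension (sectionDensityFn Ψ i) 1 L')
    {x y z : ℝ} {M : ℕ} (hx : 0 ≤ x) (hvals : ∀ n ∈ latticeBox 1 N, (((Ψ i).eval n : ℤ) : ℝ) ≤ x)
    (hvalsM : ∀ n ∈ latticeBox 1 N, (Ψ i).eval n ≤ (M : ℤ) ^ u) (hz2 : 2 ≤ z) (hzy : z ≤ y)
    (hs : Real.log y / Real.log z = 2) (hy1 : 1 ≤ Real.log y) (hzN : z ≤ (N : ℝ) ^ ((1 : ℝ) / u)) {a b v r : ℝ}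
    (ha : ∑ p ∈ (Finset.Icc 1 M).filter (fun p : ℕ => p.Prime ∧ (N : ℝ) ^ ((1 : ℝ) / u) < (p : ℝ)),
      sectionDensity Ψ i p ≤ a)
    (hb : (sectionMass Ψ K N u i j' 1 : ℝ) ≤ b) (hv : ∏ q ∈ Nat.primesBelow ⌈z⌉₊, (1 - sectionDensity Ψ i q) ≤ v)
    (hr : ∑ p ∈ (Finset.Icc 1 M).filter (fun p : ℕ => p.Prime ∧ (N : ℝ) ^ ((1 : ℝ) / u) < (p : ℝ)),
      ∑ d ∈ (Finset.range ⌈y⌉₊).filter (· ∣ primesProdBelow z),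
        |(sectionMass Ψ K N u i j' (p * d) : ℝ) - sectionDensity Ψ i (p * d) * (sectionMass Ψ K N u i j' 1 : ℝ)| ≤ r) :
    (cell Ψ K N u (i.insertNth u j') : ℝ) ≤ a * (b * (v * (G + |CI|))) + r := by
  have hg0 : ∀ p : ℕ, p.Prime → 0 ≤ sectionDensity Ψ i p := fun p hp => by
    simpa only [sectionDensityFn_apply Ψ i hp.ne_zero] using (hdim.1 p hp).1
  have hV0 : 0 ≤ ∏ q ∈ Nat.primesBelow ⌈z⌉₊, (1 - sectionDensity Ψ i q) := Finset.prod_nonneg fun q hq => by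
    have hq := Nat.prime_of_mem_primesBelow hq
    simpa only [sectionDensityFn_apply Ψ i hq.ne_zero, sub_nonneg] using (hdim.1 q hq).2.le
  have hB0 : 0 ≤ (sectionMass Ψ K N u i j' 1 : ℝ) := Nat.cast_nonneg _
  have hGC : 0 ≤ G + |CI| := by positivity
  have ha0 : 0 ≤ ∑ p ∈ (Finset.Icc 1 M).filter (fun p : ℕ => p.Prime ∧ (N : ℝ) ^ ((1 : ℝ) / u) < (p : ℝ)),
      sectionDensity Ψ i p := Finset.sum_nonneg fun p hp => hg0 p (Finset.mem_filter.mp hp).2.1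
  -- the error factor `C_I log^{-1/3} y ≤ |C_I|`
  have hE : CI * Real.log y ^ (-(1 / 3 : ℝ)) ≤ |CI| := by
    have h0 : 0 ≤ Real.log y ^ (-(1 / 3 : ℝ)) := Real.rpow_nonneg (by linarith) _
    have h1 : Real.log y ^ (-(1 / 3 : ℝ)) ≤ 1 := Real.rpow_le_one_of_one_le_of_nonpos hy1 (by norm_num)
    nlinarith [le_abs_self CI, abs_nonneg CI, mul_le_mul_of_nonneg_right (le_abs_self CI) h0]
  refine (cell_top_le_sum Ψ K N u i j' hu hvals hvalsM hzN).trans (le_trans ?_ (add_le_add (mul_le_mul ha (mul_le_mul hb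
    (mul_le_mul_of_nonneg_right hv hGC) (mul_nonneg hV0 hGC) (hB0.trans hb)) (mul_nonneg hB0 (mul_nonneg hV0 hGC))
    (ha0.trans ha)) hr))
  rw [Finset.sum_mul, ← Finset.sum_add_distrib]
  refine Finset.sum_le_sum fun p hp => ?_
  -- the linear sieve on the divisor sequence `b_p`, `p` prime, `p > N^{1/u} ≥ z`
  obtain ⟨hp, hpN⟩ := (Finset.mem_filter.mp hp).2
  have hsize : (sectionSeq Ψ K N u i j' p).size x = sectionDensity Ψ i p * (sectionMass Ψ K N u i j' 1 : ℝ) := rfl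
  have hdens : (sectionSeq Ψ K N u i j' p).densityProduct (primesProdBelow z) =
      ∏ q ∈ Nat.primesBelow ⌈z⌉₊, (1 - sectionDensity Ψ i q) := by
    rw [SieveSequence.densityProduct, primeFactors_primesProdBelow]
    refine Finset.prod_congr rfl fun q hq => ?_
    show 1 - sectionDensityFn Ψ i q = _
    rw [sectionDensityFn_apply Ψ i (Nat.prime_of_mem_primesBelow hq).ne_zero]
  have hmain := hI (sectionSeq Ψ K N u i j' p) hdim x y z hz2 hzy (by rw [hsize]; exact mul_nonneg (hg0 p hp) hB0)
  rw [hs, hF2, hsize, hdens] at hmain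
  -- its remainders are the atom's discrepancies at the moduli `p d`
  have hrem : ∀ d ∈ (Finset.range ⌈y⌉₊).filter (· ∣ primesProdBelow z), |(sectionSeq Ψ K N u i j' p).remainder d x| =
      |(sectionMass Ψ K N u i j' (p * d) : ℝ) - sectionDensity Ψ i (p * d) * (sectionMass Ψ K N u i j' 1 : ℝ)| := by
    intro d hd
    have hdP : d ∣ primesProdBelow z := (Finset.mem_filter.mp hd).2
    have hcop : Nat.Coprime p d := by
      rw [Nat.Prime.coprime_iff_not_dvd hp]
      intro hpd
      linarith [(dvd_primesProdBelow_iff hp z).mp (hpd.trans hdP)]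
    have hp1' : (1 : ℝ) ≤ p := by exact_mod_cast hp.one_lt.le
    rw [(hSF t Ψ K N u i j').2.1 p x hp.one_lt.le (fun n hn => (hvals n hn).trans (le_mul_of_one_le_left hx hp1')) d
      (ne_zero_of_dvd_ne_zero (primesProdBelow_ne_zero z) hdP) hcop]
  rw [Finset.sum_congr rfl hrem] at hmain
  refine hmain.trans (add_le_add ?_ le_rfl)
  have hgBV := mul_nonneg (mul_nonneg (hg0 p hp) hB0) hV0
  have := mul_le_mul_of_nonneg_left (add_le_add (le_refl G) hE) hgBV
  linarith

end TopCellAllAux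

open TopCellAllAux RoughCellsLocal in
/-- **`stub_prLawTopCellAll`** (registered stub, line `section-annihilator`): the top cell at EVERY roughness `u ≥ 2`
is within the budget `N/(log^{t+1} N (log log N)^B)` in the non-degenerate case — Iwaniec's linear sieve at `s = 2`
(`z = N^{1/(4u)}`, `y = N^{1/(2u)}`) on each divisor sequence `b_p`, `N^{1/u} < p ≤ ⌈(2L+1) N^{1/u}⌉`, the window
bound `∑_p g(p) ≪ 1/log N` read off `Ω(1, L')`, the crude Mertens bound for `V(z)`, the rough-tuple bound for the
fibre mass, and the atom's remainders re-indexed through `(p, d) ↦ pd`. -/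
theorem stub_prLawTopCellAll :
    SectionSeqFacts → SectionDimension → SectionMertens → PrLawTwoPrep →
      ∀ t : ℕ, 1 ≤ t → SectionLevelAt t → ∀ (L u B : ℕ), 2 ≤ u → ∃ N₀ : ℕ, ∀ N : ℕ, N₀ ≤ N →
        ∀ Ψ : Fin (t + 1) → AffLinForm 1, IsNondegenerateSystem Ψ → affLinSize Ψ N ≤ L →
        ∀ K : Set (Fin 1 → ℝ), Convex ℝ K → K ⊆ realBox 1 N →
        ∀ i : Fin (t + 1), ∀ j' : Fin t → ℕ, (∀ k, 1 ≤ j' k ∧ j' k ≤ u) →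
          (∀ p : ℕ, p.Prime → sectionDensity Ψ i p < 1) → singularProduct (Fin.removeNth i Ψ) ≠ 0 →
            (cell Ψ K N u (i.insertNth u j') : ℝ) ≤
              (N : ℝ) / (Real.log N ^ (t + 1) * Real.log (Real.log N) ^ B) := by
  intro hSF hDim hMer hPrep t _ht hA L u B hu
  have hu2 : (2 : ℝ) ≤ u := by exact_mod_cast hu
  have hu0 : (0 : ℝ) < u := by linarith
  have hL0 : (0 : ℝ) ≤ L := Nat.cast_nonneg L
  -- constants: `L'`, Iwaniec's `F` and `C_I`, Mertens' `C3`, rough tuples' `CR`, the atom's threshold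
  obtain ⟨L', hL'⟩ := hDim t
  obtain ⟨Bd, hBd, hBC⟩ := Iwaniec1980_thm1_upper_of_half_lt (κ := 1) (by norm_num)
  obtain ⟨CI, hCI⟩ := hBC L'
  set G := Real.exp Real.eulerMascheroniConstant with hG
  have hG0 : 0 < G := by rw [hG]; exact Real.exp_pos _
  have hF2 : Bd.1 2 = G := by
    have hFeq : Set.EqOn Bd.1 (iwaniecUpperSieveFun 1) (Set.Ioi 0) := hBd.eqOn_iwaniecSieveFun.1
    rw [hFeq (show (0 : ℝ) < 2 by norm_num), ← upperSieveFun_one, upperSieveFun_one_eq_holds ⟨by norm_num, by norm_num⟩, hG]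
    ring
  obtain ⟨C3, N3, h3⟩ := hMer t L 1 le_rfl
  obtain ⟨CR, NR, hR⟩ := uniformRoughTupleBound t L u (by omega)
  obtain ⟨NA, hAt⟩ := hA L u (t + 3) 1 hu
  set c : ℝ := 2 * L + 2 with hc
  have hc1 : 1 ≤ c := by rw [hc]; linarith
  set KW := (u : ℝ) * (Real.log c + |L'|) with hKW
  set KM := KW * |CR| * (4 * u * |C3|) * (G + |CI|) with hKM
  have he0 : (0 : ℝ) < 1 / (4 * u) := by positivity
  -- thresholds
  have hev : ∀ᶠ N : ℕ in atTop, (N3 ≤ N ∧ NR ≤ N ∧ NA ≤ N ∧ 3 ≤ N) ∧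
      ((2 : ℝ) ≤ (N : ℝ) ^ ((1 : ℝ) / (4 * u)) ∧ 2 * (u : ℝ) ≤ Real.log N ∧ 8 ≤ Real.log (Real.log N) ∧
        c ≤ (N : ℝ) ^ ((1 : ℝ) / 8)) ∧
      (2 * KM * Real.log (Real.log N) ^ (t + 1 + B) ≤ Real.log N ∧ 2 * Real.log (Real.log N) ^ B ≤ Real.log N) := by
    have hlog : Tendsto (fun N : ℕ => Real.log (N : ℝ)) atTop atTop := Real.tendsto_log_atTop.comp tendsto_natCast_atTop_atTop
    filter_upwards [eventually_ge_atTop N3, eventually_ge_atTop NR, eventually_ge_atTop NA, eventually_ge_atTop 3,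
      ((tendsto_rpow_atTop he0).comp tendsto_natCast_atTop_atTop).eventually_ge_atTop 2,
      hlog.eventually_ge_atTop (2 * (u : ℝ)), (Real.tendsto_log_atTop.comp hlog).eventually_ge_atTop 8,
      ((tendsto_rpow_atTop (show (0 : ℝ) < 1 / 8 by norm_num)).comp tendsto_natCast_atTop_atTop).eventually_ge_atTop c,
      eventually_mul_loglog_pow_le_log (2 * KM) (t + 1 + B), eventually_mul_loglog_pow_le_log 2 B]
      with N h1 h2 h3' h4 h5 h6 h7 h8 h9 h10
    exact ⟨⟨h1, h2, h3', h4⟩, ⟨h5, h6, h7, h8⟩, ⟨h9, h10⟩⟩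
  obtain ⟨N₀, hN₀⟩ := Filter.eventually_atTop.1 hev
  refine ⟨N₀, fun N hN Ψ hΨ hΨL K hK hKN i j' hj' hlt1 hS => ?_⟩
  obtain ⟨⟨hN3, hNR, hNA, h3N⟩, ⟨hz2, h2u, hm8, hcN⟩, ⟨hKMℓ, h2ℓ⟩⟩ := hN₀ N hN
  -- basic quantities at the scale `N`
  have hNpos : 0 < N := by omega
  have hN0 : (0 : ℝ) < N := by exact_mod_cast hNpos
  have hN1 : (1 : ℝ) ≤ N := by exact_mod_cast hNpos
  have hℓ0 : 0 < Real.log N := by linarith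
  have hm0 : 0 < Real.log (Real.log N) := by linarith
  have hdim := hL' Ψ i hlt1
  -- sieve parameters `z = N^{1/(4u)}`, `y = N^{1/(2u)}`; window start `w = N^{1/u}`; height `x = 2LN`
  have hzy : (N : ℝ) ^ ((1 : ℝ) / (4 * u)) ≤ (N : ℝ) ^ ((1 : ℝ) / (2 * u)) :=
    Real.rpow_le_rpow_of_exponent_le hN1 (one_div_le_one_div_of_le (by positivity) (by linarith))
  have hzw : (N : ℝ) ^ ((1 : ℝ) / (4 * u)) ≤ (N : ℝ) ^ ((1 : ℝ) / u) :=
    Real.rpow_le_rpow_of_exponent_le hN1 (one_div_le_one_div_of_le hu0 (by linarith))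
  have hzN : (N : ℝ) ^ ((1 : ℝ) / (4 * u)) ≤ N := by
    simpa using Real.rpow_le_rpow_of_exponent_le hN1 ((div_le_one (by positivity)).mpr (by linarith) : (1 : ℝ) / (4 * u) ≤ 1)
  have hlogz : Real.log ((N : ℝ) ^ ((1 : ℝ) / (4 * u))) = 1 / (4 * u) * Real.log N := Real.log_rpow hN0 _
  have hlogy : Real.log ((N : ℝ) ^ ((1 : ℝ) / (2 * u))) = 1 / (2 * u) * Real.log N := Real.log_rpow hN0 _
  have hs : Real.log ((N : ℝ) ^ ((1 : ℝ) / (2 * u))) / Real.log ((N : ℝ) ^ ((1 : ℝ) / (4 * u))) = 2 := by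
    rw [hlogz, hlogy]; field_simp; ring
  have hy1 : 1 ≤ Real.log ((N : ℝ) ^ ((1 : ℝ) / (2 * u))) := by
    rw [hlogy, one_div_mul_eq_div, le_div_iff₀ (by positivity)]; linarith
  have hw2 : (2 : ℝ) ≤ (N : ℝ) ^ ((1 : ℝ) / u) := hz2.trans hzw
  have hvals : ∀ n ∈ latticeBox 1 N, (((Ψ i).eval n : ℤ) : ℝ) ≤ 2 * L * N := hPrep.2.2.2.1 (t + 1) Ψ N L hNpos hΨL i
  -- window end `M = ⌈(2L+1) N^{1/u}⌉`: `M^u ≥ (2L+1)^u N ≥ 2LN ≥ ψ_i`, `M + 1 ≤ (2L+2) N^{1/u}`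
  have hvalsM : ∀ n ∈ latticeBox 1 N, (Ψ i).eval n ≤ (⌈(2 * L + 1) * (N : ℝ) ^ ((1 : ℝ) / u)⌉₊ : ℤ) ^ u := by
    intro n hn
    have hwu : ((N : ℝ) ^ ((1 : ℝ) / u)) ^ u = N := by rw [one_div, Real.rpow_inv_natCast_pow hN0.le (by omega)]
    have h : (((Ψ i).eval n : ℤ) : ℝ) ≤ ((⌈(2 * L + 1) * (N : ℝ) ^ ((1 : ℝ) / u)⌉₊ : ℕ) : ℝ) ^ u :=
      calc (((Ψ i).eval n : ℤ) : ℝ) ≤ 2 * L * N := hvals n hn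
        _ ≤ ((2 * L + 1) * (N : ℝ) ^ ((1 : ℝ) / u)) ^ u := by
            rw [mul_pow, hwu]
            exact mul_le_mul_of_nonneg_right (le_trans (by linarith) (le_self_pow₀ (by linarith) (by omega))) hN0.le
        _ ≤ _ := pow_le_pow_left₀ (by positivity) (Nat.le_ceil _) u
    exact_mod_cast h
  have hMc : (⌈(2 * L + 1) * (N : ℝ) ^ ((1 : ℝ) / u)⌉₊ : ℝ) + 1 ≤ c * (N : ℝ) ^ ((1 : ℝ) / u) := by
    have h1 : (⌈(2 * L + 1) * (N : ℝ) ^ ((1 : ℝ) / u)⌉₊ : ℝ) < (2 * L + 1) * (N : ℝ) ^ ((1 : ℝ) / u) + 1 :=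
      Nat.ceil_lt_add_one (by positivity)
    rw [hc]; linarith
  -- (1) the crude Mertens bound for `V(N^{1/(4u)})`
  have hVle : ∏ q ∈ Nat.primesBelow ⌈(N : ℝ) ^ ((1 : ℝ) / (4 * u))⌉₊, (1 - sectionDensity Ψ i q) ≤
      4 * u * |C3| * Real.log (Real.log N) / Real.log N := by
    have hlz0 : 0 < Real.log ((N : ℝ) ^ ((1 : ℝ) / (4 * u))) := by rw [hlogz]; positivity
    calc _ ≤ C3 * Real.log (Real.log N) / Real.log ((N : ℝ) ^ ((1 : ℝ) / (4 * u))) := (h3 N hN3 Ψ hΨ hΨL i hlt1 hS).2 _ hz2 hzN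
      _ ≤ |C3| * Real.log (Real.log N) / Real.log ((N : ℝ) ^ ((1 : ℝ) / (4 * u))) :=
          div_le_div_of_nonneg_right (mul_le_mul_of_nonneg_right (le_abs_self C3) hm0.le) hlz0.le
      _ = 4 * u * |C3| * Real.log (Real.log N) / Real.log N := by rw [hlogz]; field_simp
  -- (2) the fibre mass through the rough tuples of the frozen sub-system
  have hB₁ : (sectionMass Ψ K N u i j' 1 : ℝ) ≤ |CR| * Real.log (Real.log N) ^ t * N / Real.log N ^ t := by
    have h2 := hR N hNR (Fin.removeNth i Ψ) (SingularRatio.isNondegenerateSystem_removeNth hΨ i)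
      ((affLinSize_removeNth_le Ψ i N).trans hΨL)
    refine ((Nat.cast_le (α := ℝ)).mpr (hPrep.2.2.1 t Ψ K N u i j' hw2).2).trans (h2.trans ?_)
    exact div_le_div_of_nonneg_right (mul_le_mul_of_nonneg_right
      (mul_le_mul_of_nonneg_right (le_abs_self CR) (by positivity)) (Nat.cast_nonneg N)) (by positivity)
  -- (3) sieve, with the window bound (4) and the re-indexed remainders (5) still to be supplied
  refine (cell_top_le Ψ K N u i j' hSF hu hCI hF2 hG0.le hdim (by positivity) hvals hvalsM hz2 hzy hs hy1 hzw
    (a := KW / Real.log N) (r := N / Real.log N ^ (t + 3)) ?_ hB₁ hVle ?_).trans ?_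
  · -- (4) the window bound
    refine (window_sum_le hdim hw2 hc1 hMc).trans_eq ?_
    rw [Real.log_rpow hN0, hKW]; field_simp
  · -- (5) the remainders, re-indexed into the atom's squarefree moduli, then the atom
    exact le_trans (hPrep.2.2.2.2
      (fun m => |(sectionMass Ψ K N u i j' m : ℝ) - sectionDensity Ψ i m * (sectionMass Ψ K N u i j' 1 : ℝ)|) _
      ((N : ℝ) ^ ((1 : ℝ) / (4 * u))) _ ⌊(N : ℝ) ^ (1 - 1 / Real.log (Real.log N) ^ 1)⌋₊ (fun m => abs_nonneg _)
      (fun p hp => ⟨(Finset.mem_filter.mp hp).2.1, hzw.trans (Finset.mem_filter.mp hp).2.2.le⟩)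
      (fun p hp d hd => mul_le_level hu hN1 hc1 hcN hMc hm8 (Finset.mem_Icc.mp (Finset.mem_filter.mp hp).1).2
        (Finset.mem_range.mp (Finset.mem_filter.mp hd).1)))
      (hAt N hNA Ψ hΨ hΨL K hK hKN i j' hj')
  · -- (6) the budget: `KM (log log N)^{t+1} N / log^{t+2} N + N / log^{t+3} N ≤ E/2 + E/2`
    calc _ = KM * Real.log (Real.log N) ^ (t + 1) * N / Real.log N ^ (t + 2) + N / Real.log N ^ (t + 3) := by
          rw [hKM, hKW]; field_simp; ring
      _ ≤ (N : ℝ) / (Real.log N ^ (t + 1) * Real.log (Real.log N) ^ B) := budget_le (by linarith) hm0 hN0.le hKMℓ h2ℓ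

end Summit.Parity.GeneralizedHardyLittlewood.Cruxes.CellParityLaw.SectionAnnihilator

end
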